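import Summits.QuantumFields.BalabanUV.T4Continuum.Support.ShellMeasureWilsonBlock
import Summits.QuantumFields.BalabanUV.T4Continuum.Support.ShellMeasureExpChartDictionary
import Summits.QuantumFields.BalabanUV.T4Continuum.Support.ShellMeasureScalingSU2

/-!
# `T4Continuum.ShellMeasureWilsonRealizedSU2Words` — (M1)₀ REALIZED for `G = SU(2)`, file 1 of 2: the chart bonds of the
# cell's exponential fibre chart are exponentials of skew-Hermitian real-linear generators, so the plaquette holonomies
# of a sectioned configuration are sectioned words (the dictionary layer of `ShellMeasureWilsonRealizedSU2`)
# (cell `pub-balaban`, sub-cell `t4`, spine estimate NE7c (node U5b); lineage t4-ne7c-p1 = PROVER seat P1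
# «shell-measure route», generation 25; successor task (0-a) of record v3.13 §5 executed, file 1 of 2; ADDITIVE — imports
# `ShellMeasureWilsonBlock`, `ShellMeasureExpChartDictionary`, `ShellMeasureScalingSU2` only)

HONEST FRAMING.  Finite four-torus programme, rung (B)+1 only — NOT infinite volume, NOT a mass gap, NOT the Clay
problem, NOT summit progress; (B), `BetaPertHyp`, (B^μ) not consumed.  (M1) for BAŁABAN'S INDUCTIVELY DEFINED
EFFECTIVE MEASURES is NOT PRINTED (GAPS G-ne7cp1-1) and NOT moved: this is the LEVEL-0 instance (bare Wilson step: the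
tested variable of B14 (2.17) is the bare plaquette field, the weight is the Wilson weight of B12 (0.2)), WITH the
small-field window placed on the block's BOND variables (the located (LR) «window insertion after the axial gauge» is
thereby ASSUMED in the form of the weight, not proved) and WITHOUT exterior co-tests (the located (MR) untouched; the
frozen exterior is arbitrary, so its deviation is bounded by `2` per letter, not by a small-field size).  Level 0 is in
NE7c's live window only for `K ≤ N₁`.  0 sorry, 0 citations; the series enters only through the DEFINITIONS
`Setup.plaqHol` ∕ `wilsonAction`-type energy `1 − reTr` and `dist1` (B12 (0.2), B7 (19)), by `rfl`.  HONEST DEPENDENCY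
(cell): continuum YM on T⁴ ⇐ BetaPertH ∧ nine spine estimates (0/9 proved); BetaPertH ⇐ (D1) ∧ (D4) ∧ CAP+tail;
G-an2-4 gates asym, D1 and NE2/3/4.

THE THEOREM (`ShellMeasureWilsonRealizedSU2.slotAntiConcentration_wilson_su2`, file 2).  Lattice `T^{(j)}` of the cell (`Params P`, any `j`), `G = SU(2)`
(`Matrix.specialUnitaryGroup (Fin 2) ℂ` with the cell's instances); a block `Λ` of bonds with an enumeration `e` of its
`n = 3·#Λ` exponential-chart coordinates; a window half-side `0 < S ≤ 1/8` (`3S² < π²`); classifier plaquettes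
`P_u ≠ ∅` with all four bonds in `Λ`; weight plaquettes `P_w` (any); inverse coupling `β ≥ 0`; numbers `θ > 0`,
`0 ≤ δ < 1`, `0 ≤ ρ ≤ (1−δ)/2` and (SM)₀ `4·(8S)²·e^{16S} ≤ δθ`.  WEIGHT
`F(U) = χ_{Λ,1,S}(U) · exp(−β Σ_{p∈P_w} (1 − reTr U(∂p)))` (product exponential window about `1` on the block bonds ×
the sectioned Wilson weight; exterior bonds free), CLASSIFIER `u(U) = max_{p∈P_u} dist1 U(∂p)`.  CONCLUSION:
`SlotAntiConcentration ((fieldMeasure P j SU2).withDensity F) u θ ρ (2·(n + β·#P_w·8S·(8 + 32S))/(1−δ))`.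
PROOF = `ShellMeasureScalingSU2.slotAntiConcentration_realized_su2_of_coreMap` (chart identity, Jacobian and window
ride free) with (S-i)₀ `ShellMeasureWilsonWords.coreMap_sup` and (S-ii)₀ `ShellMeasureWilsonBlock.wilsonAction_contract_sub_le`
after the DICTIONARY `ShellMeasureExpChartDictionary.coe_expPoint_eq_exp`: every chart bond of `expFibreChart Λ 1 e x` is
the matrix exponential of the skew-Hermitian, real-linear generator `quatMatrix (ι x_b)`, so every plaquette holonomy
of the sectioned configuration is a word of exponentials with frozen unitary exterior letters (`coe_plaqHol_eq_wordEval`).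

WHAT THIS DOES NOT DO.  (LR)₀ (deriving the bond window from plaquette small-field conditions in the tree gauge),
(MR)₀ (exterior co-tests), anything at `j ≥ 1`; NE7c NOT proved; 0/9 spine.
-/

noncomputable section

open NormedSpace Set Function MeasureTheory

namespace Summit.QuantumFields.BalabanUV.T4Continuum.ShellMeasureWilsonRealizedSU2

open scoped ENNReal Matrix.Norms.L2Operator
open Literature.MathematicalPhysics.QuantumLattice (quatMatrix quatMatrix_neg)
open Literature.MathematicalPhysics.QuantumFieldTheory.Balaban1983to89
open T4ShellMeasure (SlotAntiConcentration)
open T4HaarSU2ExpChart (imQuat)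
open T4CubePoincare (cube mem_cube_iff)
open T4CubeChartGnomonic (SU2)
open T4CubeChartExp (toE norm_toE_sq expFibreChart expWindowDensity measurable_expWindowDensity expWindowDensity_nonneg
  expWindowDensity_le_one expWindowDensity_blind)
open T4ShellMeasureDet (blockLaw)
open T4QuatExpLog (norm_quatMatrix)
open ShellMeasureWilsonWords (scale normSum wordExp coreMap_sup interpConst_mono depth_admissible normSum_nonneg)
open ShellMeasureWilsonTrace (Letter wordEval sGen dFro TraceData)
open ShellMeasureWilsonBlock (matrixTrace wilsonAction_contract_sub_le good_gen_of_mem_skewAdjoint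
  good_frozen_of_mem_unitary)
open ShellMeasureExpChartDictionary (coe_expPoint_eq_exp quatMatrix_imQuat_mem_skewAdjoint quatMatrix_imQuat_smul)
open ShellMeasureScalingSU2 (slotAntiConcentration_realized_su2_of_coreMap)

/-- `M₂(ℂ)` -/
abbrev M₂ := Matrix (Fin 2) (Fin 2) ℂ

variable {P : Params} {j : ℕ} [DecidableEq (PBond P j)]

/-! ## §1 Chart bonds are exponentials of skew-Hermitian real-linear generators -/

section Letters

variable (Λ : Finset (PBond P j)) {n : ℕ} (e : ↥Λ × Fin 3 ≃ Fin n)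

/-- the generator of the chart bond `b` at the chart point `x`: `quatMatrix (ι x_b)`. [folklore] -/
def gen (b : ↥Λ) (x : Fin n → ℝ) : M₂ := quatMatrix (imQuat (toE fun i => x (e (b, i))))

omit [DecidableEq (PBond P j)] in
/-- ray-linearity of the generator. [folklore] -/
theorem gen_smul (b : ↥Λ) (c : ℝ) (x : Fin n → ℝ) : gen Λ e b (c • x) = (c : ℂ) • gen Λ e b x := by
  unfold gen
  rw [← quatMatrix_imQuat_smul]
  congr 2

omit [DecidableEq (PBond P j)] in
/-- the generator is skew-Hermitian. [folklore] -/
theorem gen_mem_skewAdjoint (b : ↥Λ) (x : Fin n → ℝ) : gen Λ e b x ∈ skewAdjoint M₂ :=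
  quatMatrix_imQuat_mem_skewAdjoint _

omit [DecidableEq (PBond P j)] in
/-- the generator's size on the cube: `‖gen b x‖ ≤ 2S` (operator norm = quaternion norm = Euclidean norm of the
three coordinates `≤ √3·S ≤ 2S`). [folklore] -/
theorem norm_gen_le {S : ℝ} (hS : 0 ≤ S) {x : Fin n → ℝ} (hx : x ∈ cube n S) (b : ↥Λ) :
    ‖gen Λ e b x‖ ≤ 2 * S := by
  unfold gen
  rw [norm_quatMatrix, T4HaarSU2ExpChart.norm_imQuat]
  have h2 : ‖toE fun i => x (e (b, i))‖ ^ 2 ≤ (2 * S) ^ 2 := by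
    rw [norm_toE_sq]
    rw [mem_cube_iff] at hx
    have h : ∀ i : Fin 3, (x (e (b, i))) ^ 2 ≤ S ^ 2 := fun i => by
      have := hx (e (b, i)); rw [← sq_abs]; exact pow_le_pow_left₀ (abs_nonneg _) this 2
    calc ∑ i : Fin 3, x (e (b, i)) ^ 2 ≤ ∑ _i : Fin 3, S ^ 2 := Finset.sum_le_sum fun i _ => h i
      _ = 3 * S ^ 2 := by simp
      _ ≤ (2 * S) ^ 2 := by nlinarith [sq_nonneg S]
  exact le_of_pow_le_pow_left₀ two_ne_zero (by positivity) h2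

omit [DecidableEq (PBond P j)] in
/-- THE DICTIONARY ON THE FIBRE: the chart bond of `expFibreChart Λ 1 e x` IS `exp (gen b x)`. [folklore] -/
theorem coe_chart (x : Fin n → ℝ) (b : ↥Λ) :
    ((expFibreChart Λ (1 : GaugeField P j SU2) e x b : SU2) : M₂) = exp (gen Λ e b x) := by
  unfold expFibreChart T4CubeChartExp.expChart
  have h1 : (1 : GaugeField P j SU2) (b : PBond P j) = 1 := rfl
  rw [h1, one_mul, T4CubeChartExp.expPt, coe_expPoint_eq_exp]
  rfl

/-- THE ORIENTED LETTER of the bond `b` in the sectioned configuration `V[Λ := chart x]`: a generator (`±gen`) for a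
block bond, a frozen unitary (`V b` or its adjoint) for an exterior bond. [folklore] -/
def letter (V : GaugeField P j SU2) (x : Fin n → ℝ) (b : PBond P j) (inv : Bool) : Letter M₂ :=
  if hb : b ∈ Λ then Letter.gen (if inv then -gen Λ e ⟨b, hb⟩ x else gen Λ e ⟨b, hb⟩ x)
  else Letter.frozen (if inv then star ((V b : SU2) : M₂) else ((V b : SU2) : M₂))

/-- the bond variable of the sectioned configuration, as a matrix, is the letter's factor at `c = 1`. [folklore] -/
theorem coe_update_eq_eval (V : GaugeField P j SU2) (x : Fin n → ℝ) (b : PBond P j) :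
    ((updateFinset V Λ (expFibreChart Λ 1 e x) b : SU2) : M₂) = (letter Λ e V x b false).eval 1 := by
  unfold letter
  by_cases hb : b ∈ Λ
  · rw [dif_pos hb]
    simp only [Bool.false_eq_true, ↓reduceIte, Letter.eval_gen, Complex.ofReal_one, one_smul]
    have : updateFinset V Λ (expFibreChart Λ 1 e x) b = expFibreChart Λ 1 e x ⟨b, hb⟩ := by
      simp [updateFinset, hb]
    rw [this, coe_chart]
  · rw [dif_neg hb]
    simp only [Bool.false_eq_true, ↓reduceIte, Letter.eval_frozen]
    have : updateFinset V Λ (expFibreChart Λ 1 e x) b = V b := by simp [updateFinset, hb]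
    rw [this]

/-- the same for the inverse bond variable (adjoint; `star (exp Y) = exp (−Y)` for skew `Y`). [folklore] -/
theorem coe_update_inv_eq_eval (V : GaugeField P j SU2) (x : Fin n → ℝ) (b : PBond P j) :
    (((updateFinset V Λ (expFibreChart Λ 1 e x) b)⁻¹ : SU2) : M₂) = (letter Λ e V x b true).eval 1 := by
  have hstar : (((updateFinset V Λ (expFibreChart Λ 1 e x) b)⁻¹ : SU2) : M₂) =
      star ((updateFinset V Λ (expFibreChart Λ 1 e x) b : SU2) : M₂) := rfl
  rw [hstar]
  unfold letter
  by_cases hb : b ∈ Λ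
  · rw [dif_pos hb]
    simp only [↓reduceIte, Letter.eval_gen, Complex.ofReal_one, one_smul]
    have : updateFinset V Λ (expFibreChart Λ 1 e x) b = expFibreChart Λ 1 e x ⟨b, hb⟩ := by
      simp [updateFinset, hb]
    rw [this, coe_chart, star_exp, skewAdjoint.mem_iff.mp (gen_mem_skewAdjoint Λ e ⟨b, hb⟩ x)]
  · rw [dif_neg hb]
    simp only [↓reduceIte, Letter.eval_frozen]
    have : updateFinset V Λ (expFibreChart Λ 1 e x) b = V b := by simp [updateFinset, hb]
    rw [this]

/-- the letters move along the contraction exactly as generators scale: `eval₁ (letter (c•x)) = eval_c (letter x)`.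
[folklore] -/
theorem letter_eval_smul (V : GaugeField P j SU2) (x : Fin n → ℝ) (b : PBond P j) (inv : Bool) (c : ℝ) :
    (letter Λ e V (c • x) b inv).eval 1 = (letter Λ e V x b inv).eval c := by
  unfold letter
  by_cases hb : b ∈ Λ
  · rw [dif_pos hb, dif_pos hb]
    cases inv <;> simp [Letter.eval, gen_smul, smul_neg]
  · rw [dif_neg hb, dif_neg hb]
    cases inv <;> simp [Letter.eval]

/-- the letters are admissible for `Re Tr`: generators skew-Hermitian, frozen letters unitary. [folklore] -/
theorem letter_good (V : GaugeField P j SU2) (x : Fin n → ℝ) (b : PBond P j) (inv : Bool) :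
    (letter Λ e V x b inv).Good (matrixTrace (n := Fin 2)).τ := by
  unfold letter
  by_cases hb : b ∈ Λ
  · rw [dif_pos hb]
    cases inv
    · exact good_gen_of_mem_skewAdjoint (gen_mem_skewAdjoint Λ e ⟨b, hb⟩ x)
    · exact good_gen_of_mem_skewAdjoint ((skewAdjoint M₂).neg_mem (gen_mem_skewAdjoint Λ e ⟨b, hb⟩ x))
  · rw [dif_neg hb]
    cases inv
    · exact good_frozen_of_mem_unitary (V b).2.1
    · exact good_frozen_of_mem_unitary (Unitary.star_mem (V b).2.1)

omit [DecidableEq (PBond P j)] in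
/-- sizes: a letter's generator norm is `≤ 2S` on the cube, its frozen deviation `≤ 2`. [folklore] -/
theorem letter_sizes [DecidableEq (PBond P j)] {S : ℝ} (hS : 0 ≤ S) (V : GaugeField P j SU2) {x : Fin n → ℝ}
    (hx : x ∈ cube n S) (b : PBond P j) (inv : Bool) :
    (letter Λ e V x b inv).genNorm ≤ 2 * S ∧ (letter Λ e V x b inv).dev ≤ 2 := by
  unfold letter
  by_cases hb : b ∈ Λ
  · rw [dif_pos hb]
    cases inv <;> simp only [Bool.false_eq_true, ↓reduceIte, Letter.genNorm, Letter.dev, norm_neg]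
    · exact ⟨norm_gen_le Λ e hS hx ⟨b, hb⟩, by norm_num⟩
    · exact ⟨norm_gen_le Λ e hS hx ⟨b, hb⟩, by norm_num⟩
  · rw [dif_neg hb]
    have hU : ‖((V b : SU2) : M₂)‖ = 1 := CStarRing.norm_coe_unitary ⟨_, (V b).2.1⟩
    have hUs : ‖star ((V b : SU2) : M₂)‖ = 1 := by rw [norm_star]; exact hU
    cases inv <;> simp only [Bool.false_eq_true, ↓reduceIte, Letter.genNorm, Letter.dev]
    · refine ⟨by linarith, ?_⟩
      calc ‖((V b : SU2) : M₂) - 1‖ ≤ ‖((V b : SU2) : M₂)‖ + ‖(1 : M₂)‖ := norm_sub_le _ _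
        _ = 2 := by rw [hU, norm_one]; norm_num
    · refine ⟨by linarith, ?_⟩
      calc ‖star ((V b : SU2) : M₂) - 1‖ ≤ ‖star ((V b : SU2) : M₂)‖ + ‖(1 : M₂)‖ := norm_sub_le _ _
        _ = 2 := by rw [hUs, norm_one]; norm_num

/-- THE SECTIONED PLAQUETTE WORD: the four oriented letters of `∂p`. [folklore] -/
def plaqWord (V : GaugeField P j SU2) (x : Fin n → ℝ) (p : Plaq P j) : List (Letter M₂) :=
  [letter Λ e V x ⟨p.src, p.μ⟩ false, letter Λ e V x ⟨p.src.shift p.μ, p.ν⟩ false,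
    letter Λ e V x ⟨p.src.shift p.ν, p.μ⟩ true, letter Λ e V x ⟨p.src, p.ν⟩ true]

/-- **THE PLAQUETTE HOLONOMY OF THE SECTIONED CONFIGURATION IS THE SECTIONED WORD** (as a matrix). [folklore] -/
theorem coe_plaqHol_eq_wordEval (V : GaugeField P j SU2) (x : Fin n → ℝ) (p : Plaq P j) :
    ((GaugeField.plaqHol (updateFinset V Λ (expFibreChart Λ 1 e x)) p : SU2) : M₂) =
      wordEval 1 (plaqWord Λ e V x p) := by
  unfold GaugeField.plaqHol plaqWord
  simp only [ShellMeasureWilsonTrace.wordEval_cons, ShellMeasureWilsonTrace.wordEval_nil, mul_one]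
  rw [← coe_update_eq_eval, ← coe_update_eq_eval, ← coe_update_inv_eq_eval, ← coe_update_inv_eq_eval]
  simp only [Submonoid.coe_mul, mul_assoc]

/-- along the contraction: the word at `c•x` at parameter `1` is the word at `x` at parameter `c`. [folklore] -/
theorem wordEval_plaqWord_smul (V : GaugeField P j SU2) (x : Fin n → ℝ) (p : Plaq P j) (c : ℝ) :
    wordEval 1 (plaqWord Λ e V (c • x) p) = wordEval c (plaqWord Λ e V x p) := by
  unfold plaqWord
  simp only [ShellMeasureWilsonTrace.wordEval_cons, ShellMeasureWilsonTrace.wordEval_nil, letter_eval_smul]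

/-- admissibility, size and deviation of the sectioned plaquette word on the cube: `s ≤ 8S`, `d ≤ 8`. [folklore] -/
theorem plaqWord_data {S : ℝ} (hS : 0 ≤ S) (V : GaugeField P j SU2) {x : Fin n → ℝ} (hx : x ∈ cube n S)
    (p : Plaq P j) :
    (∀ ℓ ∈ plaqWord Λ e V x p, ℓ.Good (matrixTrace (n := Fin 2)).τ) ∧
      sGen (plaqWord Λ e V x p) ≤ 8 * S ∧ dFro (plaqWord Λ e V x p) ≤ 8 := by
  refine ⟨fun ℓ hℓ => ?_, ?_, ?_⟩
  · unfold plaqWord at hℓ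
    simp only [List.mem_cons, List.not_mem_nil, or_false] at hℓ
    rcases hℓ with h | h | h | h <;> rw [h] <;> exact letter_good Λ e V x _ _
  · unfold plaqWord
    simp only [ShellMeasureWilsonTrace.sGen_cons, ShellMeasureWilsonTrace.sGen_nil]
    linarith [(letter_sizes Λ e hS V hx ⟨p.src, p.μ⟩ false).1, (letter_sizes Λ e hS V hx ⟨p.src.shift p.μ, p.ν⟩ false).1,
      (letter_sizes Λ e hS V hx ⟨p.src.shift p.ν, p.μ⟩ true).1, (letter_sizes Λ e hS V hx ⟨p.src, p.ν⟩ true).1]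
  · unfold plaqWord
    simp only [ShellMeasureWilsonTrace.dFro_cons, ShellMeasureWilsonTrace.dFro_nil]
    linarith [(letter_sizes Λ e hS V hx ⟨p.src, p.μ⟩ false).2, (letter_sizes Λ e hS V hx ⟨p.src.shift p.μ, p.ν⟩ false).2,
      (letter_sizes Λ e hS V hx ⟨p.src.shift p.ν, p.μ⟩ true).2, (letter_sizes Λ e hS V hx ⟨p.src, p.ν⟩ true).2]

/-- THE CLASSIFIER'S GENERATOR LIST of an INTERIOR plaquette (all four bonds in `Λ`). [folklore] -/
def gens (p : Plaq P j) (h1 : (⟨p.src, p.μ⟩ : PBond P j) ∈ Λ) (h2 : (⟨p.src.shift p.μ, p.ν⟩ : PBond P j) ∈ Λ)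
    (h3 : (⟨p.src.shift p.ν, p.μ⟩ : PBond P j) ∈ Λ) (h4 : (⟨p.src, p.ν⟩ : PBond P j) ∈ Λ) (x : Fin n → ℝ) : List M₂ :=
  [gen Λ e ⟨_, h1⟩ x, gen Λ e ⟨_, h2⟩ x, -gen Λ e ⟨_, h3⟩ x, -gen Λ e ⟨_, h4⟩ x]

/-- for an interior plaquette the sectioned word at parameter `c` is the word of exponentials of the SCALED
generators (exterior-independent). [folklore] -/
theorem wordEval_plaqWord_eq_wordExp (V : GaugeField P j SU2) (x : Fin n → ℝ) (p : Plaq P j)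
    (h1 : (⟨p.src, p.μ⟩ : PBond P j) ∈ Λ) (h2 : (⟨p.src.shift p.μ, p.ν⟩ : PBond P j) ∈ Λ)
    (h3 : (⟨p.src.shift p.ν, p.μ⟩ : PBond P j) ∈ Λ) (h4 : (⟨p.src, p.ν⟩ : PBond P j) ∈ Λ) (c : ℝ) :
    wordEval c (plaqWord Λ e V x p) = wordExp (scale c (gens Λ e p h1 h2 h3 h4 x)) := by
  unfold plaqWord gens letter
  rw [dif_pos h1, dif_pos h2, dif_pos h3, dif_pos h4]
  simp [wordEval, wordExp, scale, Letter.eval, smul_neg]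

omit [DecidableEq (PBond P j)] in
/-- the classifier's generator sizes on the cube: `normSum (gens p x) ≤ 8S`. [folklore] -/
theorem normSum_gens_le [DecidableEq (PBond P j)] {S : ℝ} (hS : 0 ≤ S) {x : Fin n → ℝ} (hx : x ∈ cube n S)
    (p : Plaq P j) (h1 : (⟨p.src, p.μ⟩ : PBond P j) ∈ Λ) (h2 : (⟨p.src.shift p.μ, p.ν⟩ : PBond P j) ∈ Λ)
    (h3 : (⟨p.src.shift p.ν, p.μ⟩ : PBond P j) ∈ Λ) (h4 : (⟨p.src, p.ν⟩ : PBond P j) ∈ Λ) :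
    normSum (gens Λ e p h1 h2 h3 h4 x) ≤ 8 * S := by
  unfold gens
  simp only [ShellMeasureWilsonWords.normSum_cons, ShellMeasureWilsonWords.normSum_nil, norm_neg]
  linarith [norm_gen_le Λ e hS hx ⟨_, h1⟩, norm_gen_le Λ e hS hx ⟨_, h2⟩, norm_gen_le Λ e hS hx ⟨_, h3⟩,
    norm_gen_le Λ e hS hx ⟨_, h4⟩]

end Letters

end Summit.QuantumFields.BalabanUV.T4Continuum.ShellMeasureWilsonRealizedSU2
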